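import Summits.HodgeConjecture.HodgeConjecture.Theorems.VHCAbelianSchemesRoadRegimeLocal
import Summits.HodgeConjecture.HodgeConjecture.Theorems.VHCAbelianSchemesRoadDiagonalTail
import HarnessLib

/-!
# Road №4 (`VHCAbelianSchemesRoad`) — THE LOCAL DIAGONAL HAS NO LOAD-BEARING CELL: node (U), row b02 and `HC_AV` from ANY TAIL
# `{(2m, m) : m ≥ M₀}` — indeed from ANY INFINITE SET of cells — of the LOCAL-IN-THE-FIBRE slice; fact-free, no class target, no `HC_CM`

research route conditional on HC_CM; not a corollary; Q11.4-sentence-2 already refuted in dim ≥ 3.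

THEOREMS ONLY (no definition, no named fact, no sorry; `HC_CM` occurs nowhere; nothing of the road's research content — an
admissible (twisted) datum on some fibre — is claimed). Seat core-w8 gen 0 (width copy of core-D; director-hodge g16 R16.9 plate
«stub (1′) `stub_firstCell_fourfoldMiddleTwPrime`: k0, then attempt or census»; HOME INBOX l.5582 = the census: (1′) is XL by content;
this file is its kernel half — the cell `(4, 2)` is NOT load-bearing). `--supports stmt-HodgeConjecture-26512 --as helper`; closes NO
stub or item; the route file, its `closes` glue, the binders of record and the skeleton are NOT touched.

WHY. The deciding theorem of the route (rev 27) is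
`closes hC hDiagLoc hDoor hR h₂₁ h₂₂ := hc_av_of_exceptionalRegimeAtLocal_admTw'_diagonal_two …` with
`hDiagLoc : ∀ C m, 2 ≤ m → LefAtExceptionalRegimeAtLocal (twisted door C AdmTw′) (2m) m` — the LOCAL-IN-THE-FIBRE diagonal slice
(items 23176 ∕ 26512, `VHCAbelianSchemesRoadRegimeLocal.lean`). For the GLOBAL single-datum slice `LefAtExceptionalRegimeAt`, part Y
of seat ab-andre-2 (`VHCAbelianSchemesRoadDiagonalTail.lean`) proved that EVERY TAIL `m ≥ M₀` already gives `HC_AV`, fact-free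
(`hc_av_of_exceptionalRegimeAt_twisted_diagonal_ge`), by PURE PADDING (`exists_purePadding`: `𝒳 ↦ 𝒳 × B`, same codimension, same
algebraicity locus). The engine on the per-pencil predicate `LocusNotCountableAtDeg n p` (`VHCAbelianSchemesRoadLocusEngine.lean`),
through which the LOCAL slice is consumed (`locusNotCountableAtDeg_of_exceptionalRegimeAtLocal`), was run only for `m ≥ 2`
(fact-free) and for `m ≥ 3` MODULO the class target `HCUpToDim 5` (`hc_av_of_hcUpToDim_five_of_exceptionalRegimeAtLocal_admTw'_diagonal_three`,
Markman 2025 Cor. 1.3, unrefereed): its per-pencil step `not_countable_algebraicityLocus_of_locus_diagonal` needs `G < n`. This file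
supplies the missing padding steps ON THE PREDICATE and the heads they yield:

* §1 per pencil: `not_countable_algebraicityLocus_of_locus_diagonal_tail` (node (U) at `(n, p)` from the cells `2m > G`, EVERY
  relative dimension `n`: pad by an abelian variety of dimension `G + 1` first), `not_countable_algebraicityLocus_of_locus_cell` (lower
  half `2p ≤ n`: the ONE cell `(2(n − p), n − p)` suffices — middle lift), `not_countable_algebraicityLocus_of_locus_diagonal_frequently`
  (node (U) at `(n, p)` from node (U) at INFINITELY MANY diagonal cells: pad purely up to a served cell, then the one-cell step).
* §2 `oneParameterAbelianSchemeVHCUncountable_of_locus_diagonal_tail ∕ _ge ∕ _frequently`, `abelianSchemeVHC_of_locus_diagonal_ge ∕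
  _frequently`, `hc_av_of_locus_diagonal_ge ∕ _frequently` — node (U), row b02 and `HC_AV` from node (U) on ANY TAIL ∕ on INFINITELY MANY
  cells of the diagonal, every `M₀`, FACT-FREE (`HCUpToDim 5` is idle).
* §3 door-generic heads for the LOCAL forms: `hc_av_of_lefAtDegLocal_diagonal_ge`, `hc_av_of_exceptionalRegimeAtLocal_diagonal_ge ∕
  _frequently`.
* §4 the twisted door for every admissibility notion and the road's primed notion `AdmTw'`:
  `hc_av_of_exceptionalRegimeAtLocal_twisted_diagonal_ge ∕ _frequently`, **`hc_av_of_exceptionalRegimeAtLocal_admTw'_diagonal_ge`** —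
  EXACTLY the binder shape of `closes` with `2 ≤ m ↦ M₀ ≤ m`, every `M₀` — its instances `_three` (the route file's repair path (β′)
  «slice `m ≥ 3`» in LOCAL form, now WITHOUT `HCUpToDim 5`) and `_four` (the tail stub 3′ᴸ `stub_diagonalTailTwPrimeLocal` ALONE
  closes `HC_AV`: the cells `(4, 2)` = stub 1′ and `(6, 3)` are not load-bearing), and `_frequently` (the weakest form).

CONSEQUENCES (recorded, not route edits): in the live crux «LOCAL regime 2 at every diagonal cell `m ≥ 2`» (items 23176 ∕ 26512) NO
SINGLE CELL — indeed no finite set of cells — is load-bearing for the leaf; stub 1′ `(4, 2)` can be struck by a re-key to the tail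
`m ≥ 3` at no cost in named facts. NOT claimed: any cell; implications between cells at the level of door data.

References: [BrosnanFangNiePearlstein2009] §6 Lemma 48; [Fulton1998] §10.1; [CharlesSchnell2014Notes] Prop. 11.3.11; [Lieberman1968];
[Andre1996Motifs] §6.3; [GortzWedhorn2023] Thm. 27.291; [BuchweitzFlenner2003] §5 Thm. 5.1; [Markman2025SurveySecant] Cor. 1.3 (removed here).
-/

noncomputable section

open CategoryTheory CategoryTheory.Limits AlgebraicGeometry Topology MonoidalCategory CartesianMonoidalCategory

namespace Summit.HodgeConjecture.HodgeConjecture.Ring2.SemiregularRepresentatives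

set_option linter.dupNamespace false -- the cell's namespace repeats the summit name, as in every `Ring2*` file

open Literature.AlgebraicGeometry Literature.AlgebraicGeometry.Motives Literature.AlgebraicGeometry.HodgeTheory
open Literature.AlgebraicTopology.SingularHomology
open Literature.AlgebraicGeometry.Andre1996 (andre1996_cmAnchoredPencil
  andre1996_cmHodgeClasses_algebraicallyAnchoredPencils)
open Summit.Ventures.HSemireg (ObjClass LocalVariationalHodgeFor)
open Summit.HodgeConjecture.HodgeConjecture.Ring2.Hypotheses (AbelianSchemeVHC)
open Summit.HodgeConjecture.HodgeConjecture.Ring2.Binders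
open Summit.HodgeConjecture.HodgeConjecture.Ring2.ClassTargets

variable {𝒳 S : SchemeOver ℂ}

/-! ## §1 The padding steps on the predicate, per pencil -/

/-- **Node (U) at `(n, p)` per pencil from node (U) ON THE DIAGONAL cells `(2m, m)`, `2m > G` — for EVERY relative dimension `n`**
(the locus engine's `not_countable_algebraicityLocus_of_locus_diagonal` needed `G < n`): pad the pencil by a complex abelian variety `B`
of dimension `G + 1` (`exists_purePadding`: `𝒳 × B ⟶ S`, `W♮ = pr_𝒳^* W`, same codimension `p`, SAME algebraicity locus, relative
dimension `n + G + 1 > G`, again with a section and quasi-projective total space), then run the locus engine (lower shadow, middle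
lift, one diagonal cell). FACT-FREE. [cite: BrosnanFangNiePearlstein2009, §6 Lemma 48] [cite: Lieberman1968, main theorem]
[cite: Fulton1998, §10.1 Cor. 10.1] -/
theorem not_countable_algebraicityLocus_of_locus_diagonal_tail
    {G : ℕ} (hL : ∀ m : ℕ, G < 2 * m → LocusNotCountableAtDeg (2 * m) m)
    (f : 𝒳 ⟶ S) {n : ℕ} (hf : IsSmoothProjectiveFamily f n) (h𝒳 : IsQuasiProjectiveOver 𝒳)
    [IrreducibleSpace S.left] [IsAffine S.left] [AlgebraicGeometry.Smooth S.hom] (hdim : topologicalKrullDim S.left = 1)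
    (habel : ∀ s : ComplexPoints S, ∃ A' : AbelianVariety ℂ, A'.dim = n ∧ Nonempty (A'.X ≅ fiberOver f s))
    (he : ∃ e : S ⟶ 𝒳, e ≫ f = 𝟙 S) (p : ℕ) (W : complexBetti 𝒳 (2 * p))
    (hW : ∀ s : ComplexPoints S, IsRationalClass (complexBetti.map (fiberι f s) (2 * p) W) ∧
      IsOfHodgeType n (fiberOver f s) (2 * p) p p (complexBetti.map (fiberι f s) (2 * p) W))
    {s₀ : ComplexPoints S} (hs₀ : complexBetti.map (fiberι f s₀) (2 * p) W ∈ algebraicClasses (fiberOver f s₀) p) :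
    ¬ {s : ComplexPoints S |
        complexBetti.map (fiberι f s) (2 * p) W ∈ algebraicClasses (fiberOver f s) p}.Countable := by
  obtain ⟨B, hB⟩ := exists_abelianVariety_dim_eq_succ ℂ G
  obtain ⟨hf', habel', W', hW', hiff⟩ := exists_purePadding f hf habel B p W hW
  have h := not_countable_algebraicityLocus_of_locus_diagonal hL (fst 𝒳 B.X ≫ f) hf' (by omega)
    (isQuasiProjectiveOver_tensor h𝒳 (AbelianVariety.isSmoothProjective_holds (A := B)).isProjectiveOver) hdim habel'
    (exists_section_fst_comp f he B) p W' hW' ((hiff s₀).2 hs₀)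
  have hset : {s : ComplexPoints S | complexBetti.map (fiberι (fst 𝒳 B.X ≫ f) s) (2 * p) W' ∈
        algebraicClasses (fiberOver (fst 𝒳 B.X ≫ f) s) p} =
      {s : ComplexPoints S | complexBetti.map (fiberι f s) (2 * p) W ∈ algebraicClasses (fiberOver f s) p} :=
    Set.ext fun s => hiff s
  rwa [hset] at h

/-- **Node (U) at `(n, p)` per pencil in the lower half `2p ≤ n` from node (U) at THE ONE diagonal cell `(2(n − p), n − p)`**: if
`2p = n` the pencil IS at that cell; otherwise pad by a complex abelian variety `B` of dimension `n − 2p` and take the MIDDLE LIFT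
`W♯` of `W` (`Ring2.Binders.exists_middleLift`, BFNP Lemma 48: codimension `p + dim B = n − p` on a pencil of relative dimension
`2(n − p)`, same algebraicity locus). The one-cell form of the locus engine's `…_of_locus_diagonal_of_lowerHalf` (which asks for every
cell above a bound though it uses only this one). FACT-FREE. [cite: BrosnanFangNiePearlstein2009, §6 Lemma 48]
[cite: Lieberman1968, main theorem] -/
theorem not_countable_algebraicityLocus_of_locus_cell
    (f : 𝒳 ⟶ S) {n : ℕ} (hf : IsSmoothProjectiveFamily f n) (h𝒳 : IsQuasiProjectiveOver 𝒳)
    [IrreducibleSpace S.left] [IsAffine S.left] [AlgebraicGeometry.Smooth S.hom] (hdim : topologicalKrullDim S.left = 1)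
    (habel : ∀ s : ComplexPoints S, ∃ A' : AbelianVariety ℂ, A'.dim = n ∧ Nonempty (A'.X ≅ fiberOver f s))
    (he : ∃ e : S ⟶ 𝒳, e ≫ f = 𝟙 S) {p : ℕ} (hpn : 2 * p ≤ n)
    (hcell : LocusNotCountableAtDeg (2 * (n - p)) (n - p)) (W : complexBetti 𝒳 (2 * p))
    (hW : ∀ s : ComplexPoints S, IsRationalClass (complexBetti.map (fiberι f s) (2 * p) W) ∧
      IsOfHodgeType n (fiberOver f s) (2 * p) p p (complexBetti.map (fiberι f s) (2 * p) W))
    {s₀ : ComplexPoints S} (hs₀ : complexBetti.map (fiberι f s₀) (2 * p) W ∈ algebraicClasses (fiberOver f s₀) p) :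
    ¬ {s : ComplexPoints S |
        complexBetti.map (fiberι f s) (2 * p) W ∈ algebraicClasses (fiberOver f s) p}.Countable := by
  haveI : LocallyOfFiniteType S.hom := inferInstance
  haveI : IsSeparated S.hom := (IsQuasiProjectiveOver.of_isAffine S).isSeparated
  rcases Nat.eq_or_lt_of_le hpn with hmid | hlt
  · subst hmid
    have hp : 2 * p - p = p := by omega
    rw [hp] at hcell
    exact hcell f hf h𝒳 ‹_› ‹_› ‹_› hdim habel he W hW s₀ hs₀
  · obtain ⟨B, hB⟩ := exists_abelianVariety_dim_eq_succ ℂ (n - 2 * p - 1)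
    have hpB : 2 * p + B.dim = n := by omega
    obtain ⟨hf', habel', W', hW', hiff⟩ := exists_middleLift f hf h𝒳 habel B hpB W hW
    have hmid : n + B.dim = 2 * (p + B.dim) := by omega
    rw [hmid] at hf' habel' hW'
    have hnp : n - p = p + B.dim := by omega
    rw [hnp] at hcell
    have h := hcell (fst 𝒳 B.X ≫ f) hf'
      (isQuasiProjectiveOver_tensor h𝒳 (AbelianVariety.isSmoothProjective_holds (A := B)).isProjectiveOver) ‹_› ‹_› ‹_› hdim
      habel' (exists_section_fst_comp f he B) W' hW' s₀ ((hiff s₀).2 hs₀)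
    have hset : {s : ComplexPoints S | complexBetti.map (fiberι (fst 𝒳 B.X ≫ f) s) (2 * (p + B.dim)) W' ∈
          algebraicClasses (fiberOver (fst 𝒳 B.X ≫ f) s) (p + B.dim)} =
        {s : ComplexPoints S | complexBetti.map (fiberι f s) (2 * p) W ∈ algebraicClasses (fiberOver f s) p} :=
      Set.ext fun s => hiff s
    rwa [hset] at h

/-- **Node (U) at `(n, p)` per pencil from node (U) at INFINITELY MANY diagonal cells** (`∀ M, ∃ m ≥ M, LocusNotCountableAtDeg (2m) m`):
for `p > n` the class is `0` (no `(p,p)`-classes above the dimension) and the locus is all of `S(ℂ)`; for `p ≤ n` choose a served cell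
`m ≥ n + 1`, pad purely by `B` of dimension `m + p − n ≥ 1` (`exists_purePadding`: relative dimension `m + p`, codimension `p ≤ m`, same
locus) and apply the one-cell step at `(2m, m)`. FACT-FREE. [cite: KerrPearlstein2011, §3.1] [cite: BrosnanFangNiePearlstein2009, §6 Lemma 48]
[cite: Fulton1998, §10.1 Cor. 10.1] -/
theorem not_countable_algebraicityLocus_of_locus_diagonal_frequently
    (hL : ∀ M : ℕ, ∃ m : ℕ, M ≤ m ∧ LocusNotCountableAtDeg (2 * m) m)
    (f : 𝒳 ⟶ S) {n : ℕ} (hf : IsSmoothProjectiveFamily f n) (h𝒳 : IsQuasiProjectiveOver 𝒳)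
    [IrreducibleSpace S.left] [IsAffine S.left] [AlgebraicGeometry.Smooth S.hom] (hdim : topologicalKrullDim S.left = 1)
    (habel : ∀ s : ComplexPoints S, ∃ A' : AbelianVariety ℂ, A'.dim = n ∧ Nonempty (A'.X ≅ fiberOver f s))
    (he : ∃ e : S ⟶ 𝒳, e ≫ f = 𝟙 S) (p : ℕ) (W : complexBetti 𝒳 (2 * p))
    (hW : ∀ s : ComplexPoints S, IsRationalClass (complexBetti.map (fiberι f s) (2 * p) W) ∧
      IsOfHodgeType n (fiberOver f s) (2 * p) p p (complexBetti.map (fiberι f s) (2 * p) W))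
    {s₀ : ComplexPoints S} (hs₀ : complexBetti.map (fiberι f s₀) (2 * p) W ∈ algebraicClasses (fiberOver f s₀) p) :
    ¬ {s : ComplexPoints S |
        complexBetti.map (fiberι f s) (2 * p) W ∈ algebraicClasses (fiberOver f s) p}.Countable := by
  haveI : LocallyOfFiniteType S.hom := inferInstance
  by_cases hnp : n < p
  · have huniv : {s : ComplexPoints S |
        complexBetti.map (fiberι f s) (2 * p) W ∈ algebraicClasses (fiberOver f s) p} = Set.univ :=
      Set.eq_univ_of_forall fun s => by
        rw [Set.mem_setOf_eq, (hW s).2.eq_zero_pp_of_lt hnp]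
        exact Submodule.zero_mem _
    rw [huniv]
    exact not_countable_of_isOpen_of_curve hdim isOpen_univ ⟨s₀, Set.mem_univ _⟩
  · obtain ⟨m, hm, hcell⟩ := hL (n + 1)
    obtain ⟨B, hB⟩ := exists_abelianVariety_dim_eq_succ ℂ (m + p - n - 1)
    have hBdim : n + B.dim = m + p := by omega
    obtain ⟨hf', habel', W', hW', hiff⟩ := exists_purePadding f hf habel B p W hW
    have hcell' : LocusNotCountableAtDeg (2 * (n + B.dim - p)) (n + B.dim - p) := by
      rw [show n + B.dim - p = m by omega]
      exact hcell
    have h := not_countable_algebraicityLocus_of_locus_cell (fst 𝒳 B.X ≫ f) hf'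
      (isQuasiProjectiveOver_tensor h𝒳 (AbelianVariety.isSmoothProjective_holds (A := B)).isProjectiveOver) hdim habel'
      (exists_section_fst_comp f he B) (p := p) (by omega) hcell' W' hW' ((hiff s₀).2 hs₀)
    have hset : {s : ComplexPoints S | complexBetti.map (fiberι (fst 𝒳 B.X ≫ f) s) (2 * p) W' ∈
          algebraicClasses (fiberOver (fst 𝒳 B.X ≫ f) s) p} =
        {s : ComplexPoints S | complexBetti.map (fiberι f s) (2 * p) W ∈ algebraicClasses (fiberOver f s) p} :=
      Set.ext fun s => hiff s
    rwa [hset] at h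

/-! ## §2 Node (U), row b02 and `HC_AV` from node (U) on ANY TAIL ∕ on INFINITELY MANY cells of the diagonal — fact-free -/

/-- **Node (U) from node (U) on the diagonal cells `(2m, m)` with `2m > G` — for EVERY `G`, FACT-FREE** (the locus engine's
`oneParameterAbelianSchemeVHCUncountable_of_hcUpToDim_of_locus_diagonal` with the class target `HCUpToDim G` struck).
[cite: CharlesSchnell2014Notes, Conj. 11.3.1 and Prop. 11.3.11 (proof)] [cite: BrosnanFangNiePearlstein2009, §6 Lemma 48]
[cite: Fulton1998, §10.1 Cor. 10.1] -/
theorem oneParameterAbelianSchemeVHCUncountable_of_locus_diagonal_tail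
    {G : ℕ} (hL : ∀ m : ℕ, G < 2 * m → LocusNotCountableAtDeg (2 * m) m) : OneParameterAbelianSchemeVHCUncountable := by
  intro n 𝒳 S f hf h𝒳 hirr haff hsm hdim habel he p W hW s₀ hs₀
  haveI := hirr
  haveI := haff
  haveI := hsm
  exact not_countable_algebraicityLocus_of_locus_diagonal_tail hL f hf h𝒳 hdim habel he p W hW hs₀

/-- **Node (U) from node (U) on ANY TAIL `(2m, m)`, `m ≥ M₀`, of the diagonal — every `M₀`, FACT-FREE** (the locus engine had `M₀ = 2`,
and `M₀ = 3` modulo `HCUpToDim 5`). [cite: CharlesSchnell2014Notes, Prop. 11.3.11 (proof)] [cite: BrosnanFangNiePearlstein2009, §6 Lemma 48]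
[cite: Fulton1998, §10.1 Cor. 10.1] -/
theorem oneParameterAbelianSchemeVHCUncountable_of_locus_diagonal_ge (M₀ : ℕ)
    (hL : ∀ m : ℕ, M₀ ≤ m → LocusNotCountableAtDeg (2 * m) m) : OneParameterAbelianSchemeVHCUncountable :=
  oneParameterAbelianSchemeVHCUncountable_of_locus_diagonal_tail (G := 2 * M₀) fun m hm => hL m (by omega)

/-- **Node (U) from node (U) at INFINITELY MANY diagonal cells** (`∀ M, ∃ m ≥ M, LocusNotCountableAtDeg (2m) m`) — the weakest
diagonal hypothesis the engine consumes; FACT-FREE. [cite: CharlesSchnell2014Notes, Prop. 11.3.11 (proof)]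
[cite: BrosnanFangNiePearlstein2009, §6 Lemma 48] [cite: Fulton1998, §10.1 Cor. 10.1] -/
theorem oneParameterAbelianSchemeVHCUncountable_of_locus_diagonal_frequently
    (hL : ∀ M : ℕ, ∃ m : ℕ, M ≤ m ∧ LocusNotCountableAtDeg (2 * m) m) : OneParameterAbelianSchemeVHCUncountable := by
  intro n 𝒳 S f hf h𝒳 hirr haff hsm hdim habel he p W hW s₀ hs₀
  haveI := hirr
  haveI := haff
  haveI := hsm
  exact not_countable_algebraicityLocus_of_locus_diagonal_frequently hL f hf h𝒳 hdim habel he p W hW hs₀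

/-- **Node (U) ⟺ node (U) at infinitely many diagonal cells.** [folklore] -/
theorem oneParameterAbelianSchemeVHCUncountable_iff_locus_diagonal_frequently :
    OneParameterAbelianSchemeVHCUncountable ↔ ∀ M : ℕ, ∃ m : ℕ, M ≤ m ∧ LocusNotCountableAtDeg (2 * m) m :=
  ⟨fun h M => ⟨M, le_rfl, locusNotCountableAtDeg_forall_iff.2 h (2 * M) M⟩,
    oneParameterAbelianSchemeVHCUncountable_of_locus_diagonal_frequently⟩

/-- **Row b02 from node (U) on ANY TAIL `m ≥ M₀` of the diagonal and the curve residual — no class target, no `HC_CM`.**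
[cite: CharlesSchnell2014Notes, Prop. 11.3.11 (proof)] [cite: GortzWedhorn2023, Thm. 27.291] -/
theorem abelianSchemeVHC_of_locus_diagonal_ge (M₀ : ℕ) (hL : ∀ m : ℕ, M₀ ≤ m → LocusNotCountableAtDeg (2 * m) m)
    (hqp : OneParameterAbelianSchemeQuasiProjective) : AbelianSchemeVHC :=
  abelianSchemeVHC_of_uncountable_of_oneParameterAbelianSchemeQuasiProjective hqp
    (oneParameterAbelianSchemeVHCUncountable_of_locus_diagonal_ge M₀ hL)

/-- **Row b02 from node (U) at infinitely many diagonal cells and the curve residual.** [cite: CharlesSchnell2014Notes, Prop. 11.3.11 (proof)]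
[cite: GortzWedhorn2023, Thm. 27.291] -/
theorem abelianSchemeVHC_of_locus_diagonal_frequently (hL : ∀ M : ℕ, ∃ m : ℕ, M ≤ m ∧ LocusNotCountableAtDeg (2 * m) m)
    (hqp : OneParameterAbelianSchemeQuasiProjective) : AbelianSchemeVHC :=
  abelianSchemeVHC_of_uncountable_of_oneParameterAbelianSchemeQuasiProjective hqp
    (oneParameterAbelianSchemeVHCUncountable_of_locus_diagonal_frequently hL)

/-- **`HC_AV` from node (U) on ANY TAIL `(2m, m)`, `m ≥ M₀`, of the diagonal, the curve residual and André 1996 #21/#22 — every `M₀`,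
no class target, no `HC_CM`.** Supersedes the locus engine's `hc_av_of_locus_diagonal_two` (`M₀ = 2`) and
`hc_av_of_hcUpToDim_five_of_locus_diagonal_three` (`M₀ = 3` modulo Markman ≤ 5): `HCUpToDim 5` is IDLE here.
[cite: Andre1996Motifs, §6.3 Lemmes 6.3.1–6.3.3 and Remarque 2 (p. 33)] [cite: BrosnanFangNiePearlstein2009, §6 Lemma 48]
[cite: Fulton1998, §10.1 Cor. 10.1] -/
theorem hc_av_of_locus_diagonal_ge (M₀ : ℕ) (hL : ∀ m : ℕ, M₀ ≤ m → LocusNotCountableAtDeg (2 * m) m)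
    (hqp : OneParameterAbelianSchemeQuasiProjective) (h₂₁ : andre1996_cmAnchoredPencil)
    (h₂₂ : andre1996_cmHodgeClasses_algebraicallyAnchoredPencils) :
    Theses.PadicSemiregularLift.HodgeAbelianVarieties :=
  (Ring2.Deform.HC_AV_iff_abelianSchemeVHC_of_andre1996 h₂₁ h₂₂).mpr (abelianSchemeVHC_of_locus_diagonal_ge M₀ hL hqp)

/-- **`HC_AV` from node (U) at INFINITELY MANY diagonal cells, the curve residual and André 1996 #21/#22** — the weakest diagonal
statement of this shape the road consumes; FACT-FREE. [cite: Andre1996Motifs, §6.3 Lemmes 6.3.1–6.3.3 and Remarque 2 (p. 33)]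
[cite: BrosnanFangNiePearlstein2009, §6 Lemma 48] [cite: Fulton1998, §10.1 Cor. 10.1] -/
theorem hc_av_of_locus_diagonal_frequently (hL : ∀ M : ℕ, ∃ m : ℕ, M ≤ m ∧ LocusNotCountableAtDeg (2 * m) m)
    (hqp : OneParameterAbelianSchemeQuasiProjective) (h₂₁ : andre1996_cmAnchoredPencil)
    (h₂₂ : andre1996_cmHodgeClasses_algebraicallyAnchoredPencils) :
    Theses.PadicSemiregularLift.HodgeAbelianVarieties :=
  (Ring2.Deform.HC_AV_iff_abelianSchemeVHC_of_andre1996 h₂₁ h₂₂).mpr (abelianSchemeVHC_of_locus_diagonal_frequently hL hqp)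

/-! ## §3 Door-generic heads for the LOCAL-IN-THE-FIBRE forms of the crux -/

variable {𝒪 : ObjClass}

/-- **`HC_AV` from the door, ANY TAIL `(2m, m)`, `m ≥ M₀`, of the diagonal of the LOCAL graded crux (`AdmissibleRepresentativesLefAtDegLocal`),
the curve residual and André 1996 #21/#22 — every `M₀`, no class target, no `HC_CM`.** [cite: BuchweitzFlenner2003, §5 Thm. 5.1]
[cite: Andre1996Motifs, §6.3 Lemmes 6.3.1–6.3.3] [cite: BrosnanFangNiePearlstein2009, §6 Lemma 48] [cite: Fulton1998, §10.1 Cor. 10.1] -/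
theorem hc_av_of_lefAtDegLocal_diagonal_ge (hT : LocalVariationalHodgeFor 𝒪) (M₀ : ℕ)
    (hSR : ∀ m : ℕ, M₀ ≤ m → AdmissibleRepresentativesLefAtDegLocal 𝒪 (2 * m) m)
    (hqp : OneParameterAbelianSchemeQuasiProjective) (h₂₁ : andre1996_cmAnchoredPencil)
    (h₂₂ : andre1996_cmHodgeClasses_algebraicallyAnchoredPencils) :
    Theses.PadicSemiregularLift.HodgeAbelianVarieties :=
  hc_av_of_locus_diagonal_ge M₀ (fun m hm => locusNotCountableAtDeg_of_lefAtDegLocal hT (hSR m hm)) hqp h₂₁ h₂₂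

/-- **`HC_AV` from the door and LOCAL regime 2 on ANY TAIL `m ≥ M₀` of the diagonal — door-generic, every `M₀`, no class target, no
`HC_CM`** (supersedes `hc_av_of_exceptionalRegimeAtLocal_diagonal_two` and `hc_av_of_hcUpToDim_five_of_exceptionalRegimeAtLocal_diagonal_three`
of `VHCAbelianSchemesRoadRegimeLocal.lean`: `HCUpToDim 5` is idle). [cite: vanGeemen1994HodgeAV, §2.4] [cite: BuchweitzFlenner2003, §5 Thm. 5.1]
[cite: Andre1996Motifs, §6.3 Lemmes 6.3.1–6.3.3] [cite: BrosnanFangNiePearlstein2009, §6 Lemma 48] [cite: Fulton1998, §10.1 Cor. 10.1] -/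
theorem hc_av_of_exceptionalRegimeAtLocal_diagonal_ge (hT : LocalVariationalHodgeFor 𝒪) (M₀ : ℕ)
    (hDiag : ∀ m : ℕ, M₀ ≤ m → LefAtExceptionalRegimeAtLocal 𝒪 (2 * m) m)
    (hqp : OneParameterAbelianSchemeQuasiProjective) (h₂₁ : andre1996_cmAnchoredPencil)
    (h₂₂ : andre1996_cmHodgeClasses_algebraicallyAnchoredPencils) :
    Theses.PadicSemiregularLift.HodgeAbelianVarieties :=
  hc_av_of_locus_diagonal_ge M₀ (fun m hm => locusNotCountableAtDeg_of_exceptionalRegimeAtLocal hT (hDiag m hm)) hqp h₂₁ h₂₂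

/-- **`HC_AV` from the door and LOCAL regime 2 at INFINITELY MANY diagonal cells** — door-generic, FACT-FREE; the weakest form.
[cite: vanGeemen1994HodgeAV, §2.4] [cite: BuchweitzFlenner2003, §5 Thm. 5.1] [cite: Andre1996Motifs, §6.3 Lemmes 6.3.1–6.3.3]
[cite: BrosnanFangNiePearlstein2009, §6 Lemma 48] -/
theorem hc_av_of_exceptionalRegimeAtLocal_diagonal_frequently (hT : LocalVariationalHodgeFor 𝒪)
    (hDiag : ∀ M : ℕ, ∃ m : ℕ, M ≤ m ∧ LefAtExceptionalRegimeAtLocal 𝒪 (2 * m) m)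
    (hqp : OneParameterAbelianSchemeQuasiProjective) (h₂₁ : andre1996_cmAnchoredPencil)
    (h₂₂ : andre1996_cmHodgeClasses_algebraicallyAnchoredPencils) :
    Theses.PadicSemiregularLift.HodgeAbelianVarieties :=
  hc_av_of_locus_diagonal_frequently
    (fun M => by
      obtain ⟨m, hm, h⟩ := hDiag M
      exact ⟨m, hm, locusNotCountableAtDeg_of_exceptionalRegimeAtLocal hT h⟩)
    hqp h₂₁ h₂₂

/-! ## §4 Over the TWISTED door (every admissibility notion) and the road's PRIMED notion `AdmTw'`: the binder shape of `closes` -/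

/-- **`HC_AV` in the `closes`-shape with the LOCAL diagonal slice replaced by ANY TAIL `∀ C m, M₀ ≤ m → LefAtExceptionalRegimeAtLocal
(twisted door C Adm) (2m) m`, for EVERY admissibility notion `Adm`** — K-C, the door `TwistedPerfectDoorVHC C Adm` VERBATIM, Raynaud,
André #21/#22; no class target, no `HC_CM`, every `M₀` (`hc_av_of_exceptionalRegimeAtLocal_twisted_diagonal_two` is `M₀ = 2`).
[cite: Andre1996Motifs, §6.3 Lemmes 6.3.1–6.3.3] [cite: BrosnanFangNiePearlstein2009, §6 Lemma 48]
[cite: Pridham2024Semiregularity, Rem. 2.26 with Cor. 2.25] [cite: GortzWedhorn2023, Thm. 27.291] [cite: Fulton1998, §10.1 Cor. 10.1] -/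
theorem hc_av_of_exceptionalRegimeAtLocal_twisted_diagonal_ge (hC : ChernCharacterOnBetti) {Adm : PerfectAdmissibility} (M₀ : ℕ)
    (hDiag : ∀ (C : ChernCharacterBetti) (m : ℕ), M₀ ≤ m →
      LefAtExceptionalRegimeAtLocal (twistedReflexiveClass C Adm) (2 * m) m)
    (hDoor : ∀ C : ChernCharacterBetti, TwistedPerfectDoorVHC C Adm)
    (hR : raynaud1970_abelianScheme_section_projective) (h₂₁ : andre1996_cmAnchoredPencil)
    (h₂₂ : andre1996_cmHodgeClasses_algebraicallyAnchoredPencils) :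
    Theses.PadicSemiregularLift.HodgeAbelianVarieties := by
  obtain ⟨C⟩ := hC
  exact hc_av_of_exceptionalRegimeAtLocal_diagonal_ge (𝒪 := twistedReflexiveClass C Adm) (hDoor C) M₀ (hDiag C)
    (oneParameterAbelianSchemeQuasiProjective_of_raynaud1970 hR) h₂₁ h₂₂

/-- **The same from LOCAL regime 2 at INFINITELY MANY diagonal cells, per Chern character theory** (`∀ C M, ∃ m ≥ M, …`), every `Adm`.
[cite: Andre1996Motifs, §6.3 Lemmes 6.3.1–6.3.3] [cite: BrosnanFangNiePearlstein2009, §6 Lemma 48]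
[cite: Pridham2024Semiregularity, Rem. 2.26 with Cor. 2.25] [cite: Fulton1998, §10.1 Cor. 10.1] -/
theorem hc_av_of_exceptionalRegimeAtLocal_twisted_diagonal_frequently (hC : ChernCharacterOnBetti) {Adm : PerfectAdmissibility}
    (hDiag : ∀ (C : ChernCharacterBetti) (M : ℕ), ∃ m : ℕ, M ≤ m ∧
      LefAtExceptionalRegimeAtLocal (twistedReflexiveClass C Adm) (2 * m) m)
    (hDoor : ∀ C : ChernCharacterBetti, TwistedPerfectDoorVHC C Adm)
    (hR : raynaud1970_abelianScheme_section_projective) (h₂₁ : andre1996_cmAnchoredPencil)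
    (h₂₂ : andre1996_cmHodgeClasses_algebraicallyAnchoredPencils) :
    Theses.PadicSemiregularLift.HodgeAbelianVarieties := by
  obtain ⟨C⟩ := hC
  exact hc_av_of_exceptionalRegimeAtLocal_diagonal_frequently (𝒪 := twistedReflexiveClass C Adm) (hDoor C) (hDiag C)
    (oneParameterAbelianSchemeQuasiProjective_of_raynaud1970 hR) h₂₁ h₂₂

/-- **`HC_AV` in EXACTLY the binder shape of the route's deciding theorem `closes` (rev 27) at the PRIMED twisted door
`AdmTw' := gluableSigmaAdmissible ∨ bfSingleAdmissible'`, with its LOCAL diagonal slice `hDiagLoc` (`2 ≤ m`) REPLACED BY ANY TAIL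
`M₀ ≤ m`** — every `M₀`, FACT-FREE beyond the displayed route decls (K-C, `TwistedPerfectDoorPrime`, Raynaud, André #21/#22); no
`HCUpToDim 5`, no `HC_CM`. In the live crux «LOCAL regime 2 at every diagonal cell `m ≥ 2`» (items 23176 ∕ 26512) NO SINGLE CELL —
in particular not stub 1′ = `(4, 2)` — is load-bearing for the leaf. [cite: Andre1996Motifs, §6.3 Lemmes 6.3.1–6.3.3]
[cite: BuchweitzFlenner2003, §5 Thm. 5.1] [cite: Pridham2024Semiregularity, Rem. 2.26 with Cor. 2.25]
[cite: BrosnanFangNiePearlstein2009, §6 Lemma 48] [cite: Fulton1998, §10.1 Cor. 10.1] -/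
theorem hc_av_of_exceptionalRegimeAtLocal_admTw'_diagonal_ge (hC : ChernCharacterOnBetti) (M₀ : ℕ)
    (hDiagLoc : ∀ (C : ChernCharacterBetti) (m : ℕ), M₀ ≤ m →
      LefAtExceptionalRegimeAtLocal (twistedReflexiveClass C
        (fun n X₀ I E => Summit.Ventures.HSemireg.gluableSigmaAdmissible n X₀ I E ∨ bfSingleAdmissible' n X₀ I E)) (2 * m) m)
    (hDoor : ∀ C : ChernCharacterBetti, TwistedPerfectDoorVHC C
      (fun n X₀ I E => Summit.Ventures.HSemireg.gluableSigmaAdmissible n X₀ I E ∨ bfSingleAdmissible' n X₀ I E))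
    (hR : raynaud1970_abelianScheme_section_projective) (h₂₁ : andre1996_cmAnchoredPencil)
    (h₂₂ : andre1996_cmHodgeClasses_algebraicallyAnchoredPencils) :
    Theses.PadicSemiregularLift.HodgeAbelianVarieties :=
  hc_av_of_exceptionalRegimeAtLocal_twisted_diagonal_ge hC M₀ hDiagLoc hDoor hR h₂₁ h₂₂

/-- **Repair path (β′) of the route file IN LOCAL FORM, fact-free**: `HC_AV` from K-C, `TwistedPerfectDoorPrime`, Raynaud, André
#21/#22 and LOCAL regime 2 on the diagonal from `(6, 3)` on — NO `HCUpToDim 5` (`VHCAbelianSchemesRoadRegimeLocal`'s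
`hc_av_of_hcUpToDim_five_of_exceptionalRegimeAtLocal_admTw'_diagonal_three` with Markman ≤ 5 struck): stub 1′ `(4, 2)` unused.
[cite: Andre1996Motifs, §6.3 Lemmes 6.3.1–6.3.3] [cite: BrosnanFangNiePearlstein2009, §6 Lemma 48] [cite: Fulton1998, §10.1 Cor. 10.1] -/
theorem hc_av_of_exceptionalRegimeAtLocal_admTw'_diagonal_three (hC : ChernCharacterOnBetti)
    (hDiagLoc : ∀ (C : ChernCharacterBetti) (m : ℕ), 3 ≤ m →
      LefAtExceptionalRegimeAtLocal (twistedReflexiveClass C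
        (fun n X₀ I E => Summit.Ventures.HSemireg.gluableSigmaAdmissible n X₀ I E ∨ bfSingleAdmissible' n X₀ I E)) (2 * m) m)
    (hDoor : ∀ C : ChernCharacterBetti, TwistedPerfectDoorVHC C
      (fun n X₀ I E => Summit.Ventures.HSemireg.gluableSigmaAdmissible n X₀ I E ∨ bfSingleAdmissible' n X₀ I E))
    (hR : raynaud1970_abelianScheme_section_projective) (h₂₁ : andre1996_cmAnchoredPencil)
    (h₂₂ : andre1996_cmHodgeClasses_algebraicallyAnchoredPencils) :
    Theses.PadicSemiregularLift.HodgeAbelianVarieties :=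
  hc_av_of_exceptionalRegimeAtLocal_admTw'_diagonal_ge hC 3 hDiagLoc hDoor hR h₂₁ h₂₂

/-- **The TAIL STUB 3′ᴸ `stub_diagonalTailTwPrimeLocal` (`∀ C m, 4 ≤ m → LefAtExceptionalRegimeAtLocal (tw C AdmTw') (2m) m`) ALONE
closes `HC_AV`** with K-C, `TwistedPerfectDoorPrime`, Raynaud, André #21/#22: the cells `(4, 2)` = stub 1′ and `(6, 3)` are not
load-bearing for the leaf; no `HC_CM`, no class target. [cite: Andre1996Motifs, §6.3 Lemmes 6.3.1–6.3.3]
[cite: BrosnanFangNiePearlstein2009, §6 Lemma 48] [cite: Fulton1998, §10.1 Cor. 10.1] -/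
theorem hc_av_of_exceptionalRegimeAtLocal_admTw'_diagonal_four (hC : ChernCharacterOnBetti)
    (hTail : ∀ (C : ChernCharacterBetti) (m : ℕ), 4 ≤ m →
      LefAtExceptionalRegimeAtLocal (twistedReflexiveClass C
        (fun n X₀ I E => Summit.Ventures.HSemireg.gluableSigmaAdmissible n X₀ I E ∨ bfSingleAdmissible' n X₀ I E)) (2 * m) m)
    (hDoor : ∀ C : ChernCharacterBetti, TwistedPerfectDoorVHC C
      (fun n X₀ I E => Summit.Ventures.HSemireg.gluableSigmaAdmissible n X₀ I E ∨ bfSingleAdmissible' n X₀ I E))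
    (hR : raynaud1970_abelianScheme_section_projective) (h₂₁ : andre1996_cmAnchoredPencil)
    (h₂₂ : andre1996_cmHodgeClasses_algebraicallyAnchoredPencils) :
    Theses.PadicSemiregularLift.HodgeAbelianVarieties :=
  hc_av_of_exceptionalRegimeAtLocal_admTw'_diagonal_ge hC 4 hTail hDoor hR h₂₁ h₂₂

/-- **The weakest form at `AdmTw'`**: `HC_AV` from LOCAL regime 2 at INFINITELY MANY diagonal cells (per Chern character theory),
K-C, `TwistedPerfectDoorPrime`, Raynaud, André #21/#22 — FACT-FREE. [cite: Andre1996Motifs, §6.3 Lemmes 6.3.1–6.3.3]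
[cite: BrosnanFangNiePearlstein2009, §6 Lemma 48] [cite: Fulton1998, §10.1 Cor. 10.1] -/
theorem hc_av_of_exceptionalRegimeAtLocal_admTw'_diagonal_frequently (hC : ChernCharacterOnBetti)
    (hDiagLoc : ∀ (C : ChernCharacterBetti) (M : ℕ), ∃ m : ℕ, M ≤ m ∧
      LefAtExceptionalRegimeAtLocal (twistedReflexiveClass C
        (fun n X₀ I E => Summit.Ventures.HSemireg.gluableSigmaAdmissible n X₀ I E ∨ bfSingleAdmissible' n X₀ I E)) (2 * m) m)
    (hDoor : ∀ C : ChernCharacterBetti, TwistedPerfectDoorVHC C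
      (fun n X₀ I E => Summit.Ventures.HSemireg.gluableSigmaAdmissible n X₀ I E ∨ bfSingleAdmissible' n X₀ I E))
    (hR : raynaud1970_abelianScheme_section_projective) (h₂₁ : andre1996_cmAnchoredPencil)
    (h₂₂ : andre1996_cmHodgeClasses_algebraicallyAnchoredPencils) :
    Theses.PadicSemiregularLift.HodgeAbelianVarieties :=
  hc_av_of_exceptionalRegimeAtLocal_twisted_diagonal_frequently hC hDiagLoc hDoor hR h₂₁ h₂₂

/-- **Bookkeeping: the live slice `m ≥ 2` implies every tail** (a re-key to a tail is a pure WEAKENING of the crux). [folklore] -/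
theorem exceptionalRegimeAtLocal_admTw'_diagonal_ge_of_two {M₀ : ℕ} (hM₀ : 2 ≤ M₀)
    (hDiagLoc : ∀ (C : ChernCharacterBetti) (m : ℕ), 2 ≤ m →
      LefAtExceptionalRegimeAtLocal (twistedReflexiveClass C
        (fun n X₀ I E => Summit.Ventures.HSemireg.gluableSigmaAdmissible n X₀ I E ∨ bfSingleAdmissible' n X₀ I E)) (2 * m) m) :
    ∀ (C : ChernCharacterBetti) (m : ℕ), M₀ ≤ m →
      LefAtExceptionalRegimeAtLocal (twistedReflexiveClass C
        (fun n X₀ I E => Summit.Ventures.HSemireg.gluableSigmaAdmissible n X₀ I E ∨ bfSingleAdmissible' n X₀ I E)) (2 * m) m :=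
  fun C m hm => hDiagLoc C m (le_trans hM₀ hm)

end Summit.HodgeConjecture.HodgeConjecture.Ring2.SemiregularRepresentatives

end
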